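import Summits.HodgeConjecture.HodgeConjecture.Theorems.MarkmanPartnerTransportPicardThreeK3SquaresRMTypeOpenDescent
import HarnessLib

/-!
# Route MarkmanPartnerTransport · crux `PicardThreeK3Squares` (stmt-HodgeConjecture-19652) —
# the OPENNESS PRINCIPLE for the Hodge conjecture of K3 squares on a real-multiplication Hodge locus

Cell hodge-nonav, crux #4 (HC⁴(S ⊗ S), ρ(S) ≥ 3; open core: real multiplication), programme «RATIONAL ORBIT
DENSITY» (prover seat hodge-nonav-19652-p1 gen 10; `--supports stmt-HodgeConjecture-19652`, helper).
CONDITIONAL on the named facts `Buskin2019_hodgeIsometry_algebraic` and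
`Huybrechts_K3_periodSurjective_projective` and on a DISPLAYED open-set hypothesis; credits nothing; nothing
here says HC is proved.

`hodgeConjectureFor_square_of_hc_on_open`: for a rational real-multiplication class `θ ∈ M₂₂(ℚ)`
(`k3Form`-self-adjoint) and a real eigenvalue `e ≠ 0` with an eigenprojector certificate `π ∈ ℂ[X]`
(`π(e) = 1`, `(θ_ℂ − e)·π(θ_ℂ)·θ_ℂ = 0`), THE HODGE CONJECTURE FOR K3 SQUARES IS DETERMINED ON THE HODGE
LOCUS `D_{θ,e} = {y : θ_ℂ y = e y, (y.y) = 0, (ȳ.y) > 0}` BY ANY NON-EMPTY OPEN SUBSET: if HC⁴(S' × S')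
holds for every marked projective K3 surface `S'` whose period is a `θ`-generic point of some open
`U ⊂ Λ_ℂ` meeting `D_{θ,e}`, then HC⁴(S × S) holds for EVERY marked projective K3 surface `S` whose period is
carried by a rational isometry `σ ∈ O(Λ_ℚ)` to a `θ`-generic point of `D_{θ,e}`. No generator, no
cycle and no polynomial datum about `S` enters: RATIONAL ORBIT DENSITY
(`RMTypeOrbit.exists_ratIsometry_commute_smul_mem_of_isOpen`, fact-free) moves the period into `U` inside
the isogeny class of `S` (`θ` kills the positive rational vector `σu`, `u` the marking's ample witness),
a marked surface there exists (`exists_markedK3_ratIsometry`, `markedK3_smul`), and HC⁴ transports back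
along the rational Hodge isometry (`IsogenyInvariance.hodgeConjectureFor_square_of_markedIsometry`, Buskin).
In words: on each RM Noether–Lefschetz locus, one open patch of K3 surfaces with algebraic squares forces
algebraic squares everywhere on the locus (up to isogeny the locus is a single `G_θ(ℚ)`-orbit closure).
No definition, no sorry.

References: Buskin, J. reine angew. Math. 755 (2019), Thm. 1.1, §6.2; Huybrechts, *Lectures on K3
Surfaces*, Ch. 6 Prop. 1.5, Rem. 3.3, Ch. 7 Thm. 4.1; O'Meara, *Introduction to Quadratic Forms*, §42–§43B;
Iversen, *Hyperbolic Geometry*, Ch. I §2 Prop. 2.3; van Geemen–Schütt, Forum Math. Sigma 13 (2025) e2, §3.4.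
-/

set_option linter.dupNamespace false

noncomputable section

namespace Summit.HodgeConjecture.HodgeConjecture.Theorems.MarkmanPartnerTransport.RMTypeOrbit

open CategoryTheory MonoidalCategory Polynomial
open Literature.AlgebraicGeometry Literature.AlgebraicGeometry.Motives Literature.AlgebraicGeometry.HodgeTheory
open Literature.AlgebraicGeometry.Surfaces Literature.LinearAlgebra.QuadraticForm
open Literature.AlgebraicTopology.SingularHomology
open Summit.HodgeConjecture.HodgeConjecture.Theorems.NikulinTwinTransport
open Summit.HodgeConjecture.HodgeConjecture.Theorems.MarkmanPartnerTransport.IsogenyInvariance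
open Summit.HodgeConjecture.HodgeConjecture.Theorems.MarkmanPartnerTransport.RMTypeDescent

/-- `MarkedK3[S, η, p, x]`: VERBATIM the `let MarkedK3 := …` binder of the route declaration
`PicardThreeK3Squares` (as in `…RMTypeDescent`). Local notation only. -/
local notation3 (prettyPrint := false) "MarkedK3[" S ", " η ", " p ", " x "]" =>
  (p ≠ 0 ∧ (IsIntegralClass p ∧
    (∀ q : complexBetti S (2 * 2), IsIntegralClass q → ∃ n : ℤ, q = n • p) ∧
    (∀ c : complexBetti S (2 * 1), IsIntegralClass c ↔ ∃ v : K3Index → ℤ, η c = fun i => (v i : ℂ)) ∧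
    (∀ a b : complexBetti S (2 * 1),
      cupProduct (rfl : 2 * 1 + 2 * 1 = 2 * 2) a b = k3Form (η a) (η b) • p) ∧
    IsOfHodgeType 2 S (2 * 1) 2 0 (LinearEquiv.symm η x) ∧
    (∀ τ : complexBetti S (2 * 1), IsOfHodgeType 2 S (2 * 1) 2 0 τ →
      ∃ t : ℂ, τ = t • LinearEquiv.symm η x)) ∧
    (k3Form x x = 0 ∧ 0 < (k3Form (star x) x).re ∧
      ∃ u : K3Index → ℤ, k3Form (fun i => (u i : ℂ)) x = 0 ∧ 0 < ∑ i, ∑ j, u i * k3Gram i j * u j))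

variable {S : SchemeOver ℂ}

/-- `OpenHC[θ, e]`: **HC⁴ holds for K3 squares on an open set of the Hodge locus `D_{θ,e}`** — as soon as
`D_{θ,e}` contains a `θ`-generic period point, some open `U ⊂ Λ_ℂ` meets `D_{θ,e}` and every marked
projective K3 surface with period in `U` a `θ`-generic `e`-eigenvector satisfies HC⁴ of its square.
Local notation only. -/
local notation3 (prettyPrint := false) "OpenHC[" θ ", " e "]" =>
  (∀ y₀ : K3Index → ℂ, thetaC θ y₀ = (e : ℂ) • y₀ → k3Form y₀ y₀ = 0 → 0 < (k3Form (star y₀) y₀).re →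
    (∀ v : K3Index → ℚ, k3Form (fun i => (v i : ℂ)) y₀ = 0 → Matrix.mulVec θ v = 0) →
    ∃ U : Set (K3Index → ℂ), IsOpen U ∧
      (∃ y₁ ∈ U, thetaC θ y₁ = (e : ℂ) • y₁ ∧ k3Form y₁ y₁ = 0 ∧ 0 < (k3Form (star y₁) y₁).re) ∧
      ∀ (S' : SchemeOver ℂ) (_ : IsK3Surface S') (η' : complexBetti S' (2 * 1) ≃ₗ[ℂ] (K3Index → ℂ))
        (p' : complexBetti S' (2 * 2)) (y : K3Index → ℂ), y ∈ U → MarkedK3[S', η', p', y] →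
        thetaC θ y = (e : ℂ) • y →
        (∀ v : K3Index → ℚ, k3Form (fun i => (v i : ℂ)) y = 0 → Matrix.mulVec θ v = 0) →
        HodgeConjectureFor 4 (S' ⊗ S'))

/-- **OPENNESS PRINCIPLE for the Hodge conjecture of K3 squares on a real-multiplication Hodge locus.**
For `θ ∈ M₂₂(ℚ)` self-adjoint, `e ≠ 0` real with an eigenprojector certificate `π`, and a marked projective
K3 surface `(S, η, p, x)` whose period is carried by a rational isometry `σ ∈ O(Λ_ℚ)` to a `θ`-GENERIC
point `σx` of the Hodge locus `D_{θ,e}` (every rational vector orthogonal to `σx` is killed by `θ`): if HC⁴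
holds for the squares of the marked projective K3 surfaces whose periods lie in SOME non-empty open subset
of `D_{θ,e}` (`OpenHC[θ, e]`), then `HodgeConjectureFor 4 (S ⊗ S)`. Proof: rational orbit density moves
`σx` into the open set inside the isogeny class of `S` (`exists_ratIsometry_commute_smul_mem_of_isOpen`;
`θ` kills the positive rational vector `σu`), a marked surface there exists (period surjectivity) and HC⁴
transports back along the rational Hodge isometry (Buskin: `hodgeConjectureFor_square_of_markedIsometry`).
CONDITIONAL on {`Buskin2019_hodgeIsometry_algebraic`, `Huybrechts_K3_periodSurjective_projective`} and the
displayed open-set hypothesis; credits nothing. [cite: Buskin2019, Thm. 1.1 and §6.2]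
[cite: Huybrechts2016K3, Ch. 6 Prop. 1.5, Rem. 3.3 and Ch. 7 Thm. 4.1] [cite: Omeara1963, §42–§43B] -/
theorem hodgeConjectureFor_square_of_hc_on_open
    (hB : Buskin2019_hodgeIsometry_algebraic) (hPS : Huybrechts_K3_periodSurjective_projective)
    {θ : Matrix K3Index K3Index ℚ}
    (hθsa : ∀ a b : K3Index → ℂ, k3Form (thetaC θ a) b = k3Form a (thetaC θ b))
    {e : ℝ} (he : e ≠ 0) {π : ℂ[X]} (hπe : π.eval (e : ℂ) = 1)
    (hπW : ∀ y : K3Index → ℂ,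
      thetaC θ (aeval (thetaC θ) π (thetaC θ y)) = (e : ℂ) • aeval (thetaC θ) π (thetaC θ y))
    (hOpen : OpenHC[θ, e])
    (hS : IsK3Surface S)
    (η : complexBetti S (2 * 1) ≃ₗ[ℂ] (K3Index → ℂ)) (p : complexBetti S (2 * 2)) (x : K3Index → ℂ)
    (hM : MarkedK3[S, η, p, x])
    (σ : Module.End ℂ (K3Index → ℂ)) (hσ : ∀ a b, k3Form (σ a) (σ b) = k3Form a b)
    (hσrat : ∀ v : K3Index → ℤ, ∃ w : K3Index → ℚ, σ (fun i => (v i : ℂ)) = fun i => (w i : ℂ))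
    (heig : thetaC θ (σ x) = (e : ℂ) • σ x)
    (hgenσ : ∀ v : K3Index → ℚ, k3Form (fun i => (v i : ℂ)) (σ x) = 0 → θ.mulVec v = 0) :
    HodgeConjectureFor 4 (S ⊗ S) := by
  classical
  obtain ⟨hp0, ⟨hpint, hpgen, hηint, hηcup, h20, hline⟩, hPer⟩ := hM
  have hxpos : 0 < (k3Form (star x) x).re := hPer.2.1
  -- a positive rational vector killed by `θ`
  obtain ⟨u, hux, hupos⟩ := hPer.2.2
  obtain ⟨w, hw⟩ := hσrat u
  have hθw : θ.mulVec w = 0 := hgenσ w (by rw [← hw, hσ, hux])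
  have hwpos : 0 < k3FormRat w w := by
    have h1 : (k3FormRat w w : ℚ) = ((∑ i, ∑ j, u i * k3Gram i j * u j : ℤ) : ℚ) := by
      apply Rat.cast_injective (α := ℂ)
      rw [← k3Form_ratCast, ← hw, hσ, intCast_eq_ratCast_intCast, k3Form_ratCast, k3FormRat_intCast]
    rw [h1]
    exact_mod_cast hupos
  -- RATIONAL ORBIT DENSITY
  have hPσ := periodPt_ratIsometry σ hσ hσrat hPer
  obtain ⟨U, hU, ⟨y₁, hy₁U, hy₁, h₁₁, h₁p⟩, hHC⟩ := hOpen (σ x) heig hPσ.1 hPσ.2.1 hgenσ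
  obtain ⟨g, c, hc0, hgiso, hgrat, hgcomm, hgU⟩ := exists_ratIsometry_commute_smul_mem_of_isOpen hθsa he
    hπe hπW ⟨w, hθw, hwpos⟩ heig hPσ.1 hPσ.2.1 hU hy₁U hy₁ h₁₁ h₁p
  set σ₁ : Module.End ℂ (K3Index → ℂ) := g ∘ₗ σ with hσ₁def
  have hσ₁ : ∀ a b, k3Form (σ₁ a) (σ₁ b) = k3Form a b := fun a b => by
    rw [hσ₁def, LinearMap.comp_apply, LinearMap.comp_apply, hgiso, hσ]
  have hσ₁rat : ∀ v : K3Index → ℤ, ∃ w : K3Index → ℚ, σ₁ (fun i => (v i : ℂ)) = fun i => (w i : ℂ) := by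
    intro v
    obtain ⟨w₁, hw₁⟩ := hσrat v
    obtain ⟨w₂, hw₂⟩ := ratEnd_ratCast g hgrat w₁
    exact ⟨w₂, by rw [hσ₁def, LinearMap.comp_apply, hw₁, hw₂]⟩
  have heig₁ : thetaC θ (c • σ₁ x) = (e : ℂ) • (c • σ₁ x) := by
    have hgx := LinearMap.congr_fun hgcomm (σ x)
    simp only [LinearMap.comp_apply] at hgx
    rw [hσ₁def, LinearMap.comp_apply, map_smul, ← hgx, heig, map_smul, smul_comm]
  have hgen₁ : ∀ v : K3Index → ℚ, k3Form (fun i => (v i : ℂ)) (c • σ₁ x) = 0 → θ.mulVec v = 0 := by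
    intro v hv
    obtain ⟨g', hgg', -, -, hg'rat⟩ := exists_inverse_ratIsometry g hgiso hgrat
    obtain ⟨v', hv'⟩ := ratEnd_ratCast g' hg'rat v
    have hv'x : k3Form (fun i => (v' i : ℂ)) (σ x) = 0 := by
      rw [← hv', ← hgiso (g' _) (σ x), hgg']
      rw [k3Form_smul_right, hσ₁def, LinearMap.comp_apply] at hv
      rcases mul_eq_zero.1 hv with h | h
      · exact absurd h hc0
      · exact h
    have h1 := hgenσ v' hv'x
    have h2 : thetaC θ (fun i => (v i : ℂ)) = 0 := by
      have hgv := LinearMap.congr_fun hgcomm (fun i => (v' i : ℂ))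
      simp only [LinearMap.comp_apply] at hgv
      rw [← hgg' (fun i => (v i : ℂ)), hv', ← hgv, thetaC_ratCast, h1]
      have h0 : (fun i => ((0 : K3Index → ℚ) i : ℂ)) = 0 := by funext i; simp
      rw [h0, map_zero]
    rw [thetaC_ratCast] at h2
    funext i
    have h3 := congrFun h2 i
    simp only [Pi.zero_apply] at h3
    exact_mod_cast h3
  -- a marked projective K3 surface at `c • σ₁ x ∈ U` satisfies HC⁴ by the displayed hypothesis
  obtain ⟨S', hS', η', p', hM'⟩ := exists_markedK3_ratIsometry hPS σ₁ hσ₁ hσ₁rat hPer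
  have hM'' := markedK3_smul hM' hc0
  have hcσ₁U : c • σ₁ x ∈ U := by rw [hσ₁def, LinearMap.comp_apply]; exact hgU
  have hHC' : HodgeConjectureFor 4 (S' ⊗ S') := hHC S' hS' η' p' (c • σ₁ x) hcσ₁U hM'' heig₁ hgen₁
  obtain ⟨hp'0, ⟨hp'int, hp'gen, hη'int, hη'cup, h20', hline'⟩, hPer'⟩ := hM''
  -- transport back along `σ₁⁻¹` (Buskin)
  obtain ⟨σ₁', -, hσ₁'σ, hσ₁', hσ₁'rat⟩ := exists_inverse_ratIsometry σ₁ hσ₁ hσ₁rat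
  exact hodgeConjectureFor_square_of_markedIsometry hB hS hS' η p x η' p' (c • σ₁ x) ⟨hpint, hpgen⟩ hηint
    hηcup h20 hxpos ⟨hp'int, hp'gen⟩ hη'int hη'cup h20' hPer'.2.1 σ₁' hσ₁' hσ₁'rat
    ⟨c, by rw [map_smul, hσ₁'σ]⟩ hHC'


end Summit.HodgeConjecture.HodgeConjecture.Theorems.MarkmanPartnerTransport.RMTypeOrbit

end
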